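import Mathlib
import Summits.MatrixMultiplication.Statement
import Summits.MatrixMultiplication.MatrixMultiplication.Theorems.GraphEquationsChainPurification

/-!
# The fan specimen: past constant fields and order two, one LINEAR field purifies (`GraphEquations`, M75)

Decomp-mm node «GraphEquations» (lens 5); attacked leaf `MultiplicityReduction`
(stmt-MatrixMultiplication-27806); target VERBATIM: `_root_.MatrixMultiplication`.

Rung `4` of the degree ladder (`EquationsForceMultiplicationDeg 4`, M67) after M71–M74.  The two
purification engines in the tree — bounded-order purification at order `2`
(`boundedOrderPurification_two`: the test IDEAL initially isolated to order `≤ 2` over some base pair)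
and the CONSTANT vertical step (M72: a non-zero constant `γ` with `D_γ t ∈ I(Γ)` for every test) — both
miss the following correct degree-`4` system, which ONE deflation step along a fibre field LINEAR in the
base variables (`3` gates) purifies over every base pair.
**The fan** (`fanTest`, `n² ≥ 3`, positions `p₀, p₁, p₂, …`, base variable `y = a_{p₀}`):
`t₀ = y·f_{p₁} + f_{p₀}`, `t₁ = f_{p₂} − f_{p₁}²`, `t₂ = f_{p₂}²`, `t_i = f_{p_i}` (`i ≥ 3`).
* `exists_fanSystem`: CORRECT, degree `≤ 4`, test ideal initially isolated to NO order `K ≤ 3` over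
  ANY base pair (masking table `F_{p₀} ↦ −y·s, F_{p₁} ↦ s, F_{p₂} ↦ s², F_{p_i} ↦ s⁴`, certificate
  lemma of M71), and NO non-zero constant kernel field (`fan_constField_eq_zero` — the masked
  direction `(F_{p₀}, F_{p₁}) ∝ (−y, 1)` ROTATES with the base);
* `fan_purified_by_linear_field`: `μ = (μ_{p₁} = −1, μ_{p₀} = y, 0 …)` is a kernel field
  (`D_μ t₀ = 0`, `D_μ t₁ = 2 f_{p₁}`), exposed by the `3`-gate program `fanFieldSystem`; ONE
  forward-mode deflation along it (`forwardModeAD`, M16) is CORRECT and REDUCED at the graph point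
  over every base pair, cost `≤ 4·cost + 3`; `fan_specimen` packages both halves.
So at rung `4` the currency is neither isolation ORDER (M71) nor constant deflation (M72) but the
COST OF POLYNOMIAL KERNEL FIELDS `μ ∈ ker_{ℂ[a,b]} M_E` (`M_E` = matrix of fibre-linear parts).

No `sorry`.  Sources: [BurgisserClausenShokrollahi1997, §7.1 (forward mode), Problem 16.3];
Leykin–Verschelde–Zhao 2006 [doi:10.1016/j.tcs.2006.02.018] (deflation; context).
-/

set_option linter.dupNamespace false

noncomputable section
open scoped BigOperators

namespace Summit.MatrixMultiplication.MatrixMultiplication.Theorems.GraphEquations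

open MvPolynomial Matrix Literature.Computability.AlgebraicComplexity
open Literature.Computability.AlgebraicComplexity.ArithCircuit

variable {n : ℕ}

/-- The pivot base variable `y = a_{p₀}` (an entry of `A`). -/
def fanY (h3 : 3 ≤ n * n) : MatMulVars n := Sum.inl (chainPos n ⟨0, by omega⟩)

/-- The fan tests: head `y f_{p₁} + f_{p₀}`, link `f_{p₂} − f_{p₁}²`, square `f_{p₂}²`, then `f_{p_i}`. -/
def fanTest (h3 : 3 ≤ n * n) (i : Fin (n * n)) : MvPolynomial (GraphVars n) ℂ :=
  if i.val = 0 then liftAB n (X (fanY h3)) * generator n (chainPos n ⟨1, by omega⟩) +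
      generator n (chainPos n ⟨0, by omega⟩)
  else if i.val = 1 then generator n (chainPos n ⟨2, by omega⟩) - generator n (chainPos n ⟨1, by omega⟩) ^ 2
  else if i.val = 2 then generator n (chainPos n ⟨2, by omega⟩) ^ 2
  else generator n (chainPos n i)

/-- The fan tests in fibre coordinates (`liftF`). -/
def fanG (h3 : 3 ≤ n * n) (i : Fin (n * n)) : FPoly n :=
  if i.val = 0 then C (X (fanY h3)) * X (chainPos n ⟨1, by omega⟩) + X (chainPos n ⟨0, by omega⟩)
  else if i.val = 1 then X (chainPos n ⟨2, by omega⟩) - X (chainPos n ⟨1, by omega⟩) ^ 2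
  else if i.val = 2 then X (chainPos n ⟨2, by omega⟩) ^ 2
  else X (chainPos n i)

/-- `liftF tᵢ = Gᵢ`. -/
theorem liftF_fanTest (h3 : 3 ≤ n * n) (i : Fin (n * n)) : liftF n (fanTest h3 i) = fanG h3 i := by
  unfold fanTest fanG
  split_ifs <;> simp only [map_add, map_sub, map_mul, map_pow, liftF_generator, liftF_liftAB]

/-- `substF Gᵢ = tᵢ`. -/
theorem substF_fanG (h3 : 3 ≤ n * n) (i : Fin (n * n)) : substF n (fanG h3 i) = fanTest h3 i := by
  rw [← liftF_fanTest, substF_liftF]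

/-- The fan tests have degree `≤ 4`. -/
theorem totalDegree_fanTest_le (h3 : 3 ≤ n * n) (i : Fin (n * n)) : (fanTest h3 i).totalDegree ≤ 4 := by
  have hg : ∀ q, (generator n q).totalDegree ≤ 2 := totalDegree_generator_le_two n
  have hy : (liftAB n (X (fanY h3) : MvPolynomial (MatMulVars n) ℂ)).totalDegree ≤ 1 := by
    rw [liftAB_X]; exact (totalDegree_X _).le
  unfold fanTest
  split_ifs
  · refine (totalDegree_add _ _).trans (max_le ((totalDegree_mul _ _).trans ?_) ((hg _).trans (by norm_num)))
    have := hg (chainPos n ⟨1, by omega⟩); omega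
  · refine (totalDegree_sub _ _).trans (max_le ((hg _).trans (by norm_num)) ((totalDegree_pow _ _).trans ?_))
    have := hg (chainPos n ⟨1, by omega⟩); omega
  · refine (totalDegree_pow _ _).trans ?_
    have := hg (chainPos n ⟨2, by omega⟩); omega
  · exact (hg _).trans (by norm_num)

/-- Every position is some `pᵢ`. -/
theorem exists_chainPos_eq (q : Fin n × Fin n) : ∃ i, chainPos n i = q :=
  ⟨finProdFinEquiv q, by simp [chainPos]⟩

/-- Case analysis over the positions `p₀, p₁, p₂` and the rest. -/
theorem chainPos_cases (h3 : 3 ≤ n * n) {P : Fin n × Fin n → Prop} (h0 : P (chainPos n ⟨0, by omega⟩))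
    (h1 : P (chainPos n ⟨1, by omega⟩)) (h2 : P (chainPos n ⟨2, by omega⟩))
    (hrest : ∀ i : Fin (n * n), i.val ≠ 0 → i.val ≠ 1 → i.val ≠ 2 → P (chainPos n i)) (q : Fin n × Fin n) :
    P q := by
  obtain ⟨i, rfl⟩ := exists_chainPos_eq q
  by_cases hi0 : i.val = 0
  · rw [show i = ⟨0, by omega⟩ from Fin.ext hi0]; exact h0
  by_cases hi1 : i.val = 1
  · rw [show i = ⟨1, by omega⟩ from Fin.ext hi1]; exact h1
  by_cases hi2 : i.val = 2
  · rw [show i = ⟨2, by omega⟩ from Fin.ext hi2]; exact h2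
  exact hrest i hi0 hi1 hi2

/-- **The fan cuts out the graph.** -/
theorem fanTest_zero_iff (h3 : 3 ≤ n * n) (x : GraphVars n → ℂ) :
    (∀ i, eval x (fanTest h3 i) = 0) ↔ x ∈ mmGraph n := by
  rw [mem_mmGraph_iff_eval_generator]
  constructor
  · intro h
    have h2 : eval x (generator n (chainPos n ⟨2, by omega⟩)) = 0 :=
      pow_eq_zero_iff (n := 2) (by norm_num) |>.1 (by
        simpa only [fanTest, show (2 : ℕ) ≠ 0 from by norm_num, show (2 : ℕ) ≠ 1 from by norm_num,
          if_false, if_true, map_pow] using h ⟨2, by omega⟩)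
    have h1 : eval x (generator n (chainPos n ⟨1, by omega⟩)) = 0 :=
      pow_eq_zero_iff (n := 2) (by norm_num) |>.1 (by
        simpa only [fanTest, show (1 : ℕ) ≠ 0 from by norm_num, if_false, if_true, map_sub, map_pow, h2,
          zero_sub, neg_eq_zero] using h ⟨1, by omega⟩)
    have h0 : eval x (generator n (chainPos n ⟨0, by omega⟩)) = 0 := by
      simpa only [fanTest, if_true, map_add, map_mul, h1, mul_zero, zero_add] using h ⟨0, by omega⟩
    refine chainPos_cases h3 h0 h1 h2 fun i hi0 hi1 hi2 => ?_
    simpa only [fanTest, hi0, hi1, hi2, if_false] using h i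
  · intro h i
    unfold fanTest
    split_ifs <;> simp [map_add, map_sub, map_mul, map_pow, h]

/-- Masking weights: `F_{p₀}, F_{p₁} ↦ 1`, `F_{p₂} ↦ 2`, the rest `↦ 4`. -/
def fanW (n : ℕ) (v : Fin n × Fin n) : ℕ :=
  if (finProdFinEquiv v).val = 0 then 1 else if (finProdFinEquiv v).val = 1 then 1
  else if (finProdFinEquiv v).val = 2 then 2 else 4

/-- Masking coefficients: `F_{p₀} ↦ −y`, all others `↦ 1`. -/
def fanLam (h3 : 3 ≤ n * n) (v : Fin n × Fin n) : MvPolynomial (MatMulVars n) ℂ :=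
  if (finProdFinEquiv v).val = 0 then -X (fanY h3) else 1

/-- The weights at the positions. -/
theorem fanW_chainPos (i : Fin (n * n)) :
    fanW n (chainPos n i) = if i.val = 0 then 1 else if i.val = 1 then 1 else if i.val = 2 then 2 else 4 := by
  simp only [fanW, chainPos, Equiv.apply_symm_apply]

/-- The coefficients at the positions. -/
theorem fanLam_chainPos (h3 : 3 ≤ n * n) (i : Fin (n * n)) :
    fanLam h3 (chainPos n i) = if i.val = 0 then -X (fanY h3) else 1 := by
  simp only [fanLam, chainPos, Equiv.apply_symm_apply]

/-- All weights are positive. -/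
theorem one_le_fanW (v : Fin n × Fin n) : 1 ≤ fanW n v := by
  unfold fanW; split_ifs <;> norm_num

/-- `s⁴` divides the masked image of every fan test. -/
theorem X_pow_dvd_maskHom_fanTest (h3 : 3 ≤ n * n) (i : Fin (n * n)) :
    Polynomial.X ^ 4 ∣ maskHom (fanLam h3) (fanW n) (liftF n (fanTest h3 i)) := by
  rw [liftF_fanTest]
  unfold fanG
  have hX : ∀ j : Fin (n * n), maskHom (fanLam h3) (fanW n) (X (chainPos n j)) =
      Polynomial.C (fanLam h3 (chainPos n j)) * Polynomial.X ^ (fanW n (chainPos n j)) := fun j => by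
    rw [maskHom, aeval_X]
  have hC : ∀ p : MvPolynomial (MatMulVars n) ℂ, maskHom (fanLam h3) (fanW n) (C p) = Polynomial.C p :=
    fun p => by rw [maskHom, aeval_C, Polynomial.algebraMap_eq]
  split_ifs with h0 h1 h2
  · refine ⟨0, ?_⟩
    rw [map_add, map_mul, hC, hX, hX, fanLam_chainPos, fanLam_chainPos, fanW_chainPos, fanW_chainPos]
    simp only [show (1 : ℕ) ≠ 0 from by norm_num, if_true, if_false, mul_zero, map_one, one_mul, map_neg,
      pow_one]
    ring
  · refine ⟨0, ?_⟩
    rw [map_sub, map_pow, hX, hX, fanLam_chainPos, fanLam_chainPos, fanW_chainPos, fanW_chainPos]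
    simp only [show (1 : ℕ) ≠ 0 from by norm_num, show (2 : ℕ) ≠ 0 from by norm_num,
      show (2 : ℕ) ≠ 1 from by norm_num, if_true, if_false, mul_zero, map_one, one_mul]
    ring
  · refine ⟨1, ?_⟩
    rw [map_pow, hX, fanLam_chainPos, fanW_chainPos]
    simp only [show (2 : ℕ) ≠ 0 from by norm_num, show (2 : ℕ) ≠ 1 from by norm_num, if_true, if_false,
      map_one, one_mul, mul_one]
    ring
  · refine ⟨1, ?_⟩
    rw [hX, fanLam_chainPos, fanW_chainPos]
    simp only [h0, h1, h2, if_false, map_one, one_mul, mul_one]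

/-- `D_γ` is compatible with subtraction. -/
theorem polarDeriv_sub' {σ R : Type*} [CommRing R] [Fintype σ] [DecidableEq σ] (γ : σ → R)
    (P Q : MvPolynomial σ R) : polarDeriv γ (P - Q) = polarDeriv γ P - polarDeriv γ Q := by
  rw [sub_eq_add_neg, polarDeriv_add, ← neg_one_mul Q, ← C_1, ← C_neg, polarDeriv_C_mul, C_neg, C_1,
    neg_one_mul, sub_eq_add_neg]

/-- The constant term of `D_μ Gᵢ`: the pairing of `μ` with the fibre-linear part of the fan tests. -/
theorem constantCoeff_polarDeriv_fanG (h3 : 3 ≤ n * n)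
    (μ : Fin n × Fin n → MvPolynomial (MatMulVars n) ℂ) (i : Fin (n * n)) :
    constantCoeff (polarDeriv μ (fanG h3 i)) =
      if i.val = 0 then X (fanY h3) * μ (chainPos n ⟨1, by omega⟩) + μ (chainPos n ⟨0, by omega⟩)
      else if i.val = 1 then μ (chainPos n ⟨2, by omega⟩) else if i.val = 2 then 0
      else μ (chainPos n i) := by
  classical
  unfold fanG
  split_ifs <;> simp only [polarDeriv_add, polarDeriv_sub', polarDeriv_X, sq, polarDeriv_mul,
    polarDeriv_C, map_add, map_sub, map_mul, constantCoeff_C, constantCoeff_X, mul_zero, zero_mul,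
    add_zero, zero_add, sub_zero]

/-- **Kernel-field criterion for the fan**: `D_μ tᵢ ∈ I(Γ)` iff that constant term vanishes. -/
theorem derivC_fanTest_mem_iff (h3 : 3 ≤ n * n) (μ : Fin n × Fin n → MvPolynomial (MatMulVars n) ℂ)
    (i : Fin (n * n)) :
    derivC μ (fanTest h3 i) ∈ graphIdeal n ↔ constantCoeff (polarDeriv μ (fanG h3 i)) = 0 := by
  rw [← substF_fanG, ← substF_polarDeriv, substF_mem_graphIdeal_iff]

/-- **NO CONSTANT KERNEL FIELD**: a constant field `γ` with `D_γ tᵢ ∈ I(Γ)` for all `i` is zero —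
the masked direction `(F_{p₀}, F_{p₁}) ∝ (−y, 1)` rotates with the base. -/
theorem fan_constField_eq_zero (h3 : 3 ≤ n * n) (γ : Fin n × Fin n → ℂ)
    (h : ∀ i, derivC (fun q => C (γ q)) (fanTest h3 i) ∈ graphIdeal n) : γ = 0 := by
  classical
  have hc : ∀ i, constantCoeff (polarDeriv (fun q => C (γ q)) (fanG h3 i)) = 0 :=
    fun i => (derivC_fanTest_mem_iff h3 _ i).1 (h i)
  have h0 := hc ⟨0, by omega⟩
  have h1 := hc ⟨1, by omega⟩
  simp only [constantCoeff_polarDeriv_fanG, if_true, show (1 : ℕ) ≠ 0 from by norm_num, if_false] at h0 h1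
  -- evaluate `y·γ_{p₁} + γ_{p₀} = 0` at `y = 0` and `y = 1`
  have hp0 : γ (chainPos n ⟨0, by omega⟩) = 0 := by
    have := congrArg (eval fun _ => (0 : ℂ)) h0
    simpa [eval_X] using this
  have hp1 : γ (chainPos n ⟨1, by omega⟩) = 0 := by
    have := congrArg (eval fun _ => (1 : ℂ)) h0
    simpa [eval_X, hp0] using this
  funext q
  refine chainPos_cases h3 (P := fun q => γ q = 0) hp0 hp1 (by simpa using h1) (fun i hi0 hi1 hi2 => ?_) q
  simpa [constantCoeff_polarDeriv_fanG, hi0, hi1, hi2] using hc i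

/-- The field `μ`: `μ_{p₁} = −1`, `μ_{p₀} = y`, `0` elsewhere — LINEAR in the base variables. -/
def fanField (h3 : 3 ≤ n * n) (q : Fin n × Fin n) : MvPolynomial (MatMulVars n) ℂ :=
  if (finProdFinEquiv q).val = 0 then X (fanY h3) else if (finProdFinEquiv q).val = 1 then -1 else 0

/-- The field at the positions. -/
theorem fanField_chainPos (h3 : 3 ≤ n * n) (i : Fin (n * n)) :
    fanField h3 (chainPos n i) = if i.val = 0 then X (fanY h3) else if i.val = 1 then -1 else 0 := by
  simp only [fanField, chainPos, Equiv.apply_symm_apply]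

/-- `μ` is a kernel field of the fan: `D_μ t₀ = −y + y = 0`, `D_μ t₁ = 2 f_{p₁}`, the rest `0`. -/
theorem fanField_kernel (h3 : 3 ≤ n * n) (i : Fin (n * n)) :
    derivC (fanField h3) (fanTest h3 i) ∈ graphIdeal n := by
  rw [derivC_fanTest_mem_iff, constantCoeff_polarDeriv_fanG]
  split_ifs <;> simp [fanField_chainPos, *]

/-- The program exposing `μ`: gates `−1`, `y`, `0` (fan-in `≤ 1`), all tested. -/
def fanFieldSystem (h3 : 3 ≤ n * n) : EqSystem n where
  circuit := { gates := [Gate.sum [((-1 : ℂ), .const 1)], Gate.sum [((1 : ℂ), .var (Sum.inl (fanY h3)))],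
      Gate.sum []], output := .const 0 }
  tests := [0, 1, 2]

/-- The field program is fan-in two (cost `3`). -/
theorem fanFieldSystem_isFanInTwo (h3 : 3 ≤ n * n) : (fanFieldSystem h3).circuit.IsFanInTwo := by
  intro g hg
  simp only [fanFieldSystem, List.mem_cons, List.mem_nil_iff, or_false] at hg
  rcases hg with rfl | rfl | rfl <;> simp [Gate.fanIn, Gate.args]

/-- Its three tested values: `−1`, `y`, `0` (lifted from the base ring). -/
theorem fanFieldSystem_testPoly (h3 : 3 ≤ n * n) :
    (fanFieldSystem h3).testPoly 0 = liftAB n (-1) ∧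
      (fanFieldSystem h3).testPoly 1 = liftAB n (X (fanY h3)) ∧ (fanFieldSystem h3).testPoly 2 = liftAB n 0 := by
  simp only [EqSystem.testPoly]
  refine ⟨?_, ?_, ?_⟩ <;> rw [getD_gateValues_eq_eval_take _ (by simp [fanFieldSystem])] <;>
    simp [fanFieldSystem, Gate.eval, Operand.eval, smul_eq_C_mul, liftAB_X]

/-- The program exposes `μ_q` for every position `q`. -/
theorem fanFieldSystem_exposes (h3 : 3 ≤ n * n) (q : Fin n × Fin n) :
    ∃ j ∈ (fanFieldSystem h3).tests, (fanFieldSystem h3).testPoly j = liftAB n (fanField h3 q) := by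
  obtain ⟨h0, h1, h2⟩ := fanFieldSystem_testPoly h3
  have ht : (fanFieldSystem h3).tests = [0, 1, 2] := rfl
  obtain ⟨i, rfl⟩ := exists_chainPos_eq q
  rw [fanField_chainPos, ht]
  split_ifs
  · exact ⟨1, by simp, h1⟩
  · exact ⟨0, by simp, h0⟩
  · exact ⟨2, by simp, h2⟩

/-- **ONE LINEAR-FIELD VERTICAL STEP PURIFIES THE FAN** over EVERY base pair, at cost `4·cost + 3`. -/
theorem fan_purified_by_linear_field (h3 : 3 ≤ n * n) {E : EqSystem n} (hE : E.Correct)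
    (hto : ∀ j ∈ E.tests, ∃ i, E.testPoly j = fanTest h3 i)
    (hfrom : ∀ i, ∃ j ∈ E.tests, E.testPoly j = fanTest h3 i) :
    ∃ E' : EqSystem n, E'.Correct ∧ (∀ y, E'.ReducedAt (graphPoint y)) ∧ E'.cost ≤ 4 * E.cost + 3 := by
  classical
  obtain ⟨E', hfan, hD, hshape, hcost⟩ := forwardModeAD n E (fanFieldSystem h3) (fanField h3) hE.1
    (fanFieldSystem_isFanInTwo h3) (fanFieldSystem_exposes h3)
  have hKF : ∀ j ∈ E.tests, derivC (fanField h3) (E.testPoly j) ∈ graphIdeal n := fun j hj => by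
    obtain ⟨i, hi⟩ := hto j hj
    rw [hi]; exact fanField_kernel h3 i
  have hE' : E'.Correct := hE.of_deflatesTo hfan hD hshape hKF
  refine ⟨E', hE', fun y => EqSystem.reducedAt_of_idealInitIsolatedAt_one hE' ?_, hcost⟩
  have hmem : ∀ t, (∃ j' ∈ E'.tests, E'.testPoly j' = t) →
      t ∈ Ideal.span (Set.range fun o' : Fin E'.tests.length => E'.testPoly (E'.tests.get o')) := by
    rintro t ⟨j', hj', rfl⟩
    obtain ⟨o', ho'⟩ := List.get_of_mem hj'
    exact Ideal.subset_span ⟨o', congrArg E'.testPoly ho'⟩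
  have i1lt : 1 < n * n := by omega
  -- `D_μ t₁ = 2 f_{p₁}` in fibre coordinates
  have hG' : polarDeriv (fanField h3) (fanG h3 ⟨1, i1lt⟩) = C 2 * X (chainPos n ⟨1, i1lt⟩) := by
    simp only [fanG, show (1 : ℕ) ≠ 0 from by norm_num, if_false, if_true, polarDeriv_sub', polarDeriv_X,
      sq, polarDeriv_mul, fanField_chainPos, show (2 : ℕ) ≠ 0 from by norm_num,
      show (2 : ℕ) ≠ 1 from by norm_num, map_zero, map_neg, map_one, map_ofNat]
    ring
  refine ⟨n * n + 1, Fin.append (fun i => fanTest h3 i) (fun _ => derivC (fanField h3) (fanTest h3 ⟨1, i1lt⟩)),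
    fun o => ?_, fun _ => 1, Fin.append (fanG h3) (fun _ => C 2 * X (chainPos n ⟨1, i1lt⟩)),
    fun _ => le_rfl, fun o => ?_, fun o j hj => ?_, fun F₀ hF => ?_⟩
  · induction o using Fin.addCases with
    | left i =>
      simp only [Fin.append_left]
      obtain ⟨j, hj, hji⟩ := hfrom i
      obtain ⟨j', hj', h'⟩ := hD.1 j hj
      exact hmem _ ⟨j', hj', h'.trans hji⟩
    | right i =>
      simp only [Fin.append_right]
      obtain ⟨j, hj, hji⟩ := hfrom ⟨1, i1lt⟩
      obtain ⟨j', hj', h'⟩ := hD.2 j hj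
      exact hmem _ ⟨j', hj', by rw [h', hji]⟩
  · induction o using Fin.addCases with
    | left i => simp only [Fin.append_left, substF_fanG]
    | right i => simp only [Fin.append_right]; rw [← hG', substF_polarDeriv, substF_fanG]
  · have hj0 : j = 0 := by simp only at hj; omega
    subst hj0
    induction o using Fin.addCases with
    | left i =>
      simp only [Fin.append_left]
      rw [homogeneousComponent_zero, ← constantCoeff_eq, C_eq_zero]
      unfold fanG; split_ifs <;> simp [constantCoeff_X]
    | right i =>
      simp only [Fin.append_right]
      rw [homogeneousComponent_zero, ← constantCoeff_eq, C_eq_zero]; simp [constantCoeff_X]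
  · -- the order-one forms `y F_{p₁} + F_{p₀}`, `F_{p₂}`, `2 F_{p₁}`, `F_{p_i}` isolate `0`
    have hX : ∀ q : Fin n × Fin n, homogeneousComponent 1 (X q : FPoly n) = X q := fun q =>
      by rw [homogeneousComponent_of_mem ((mem_homogeneousSubmodule _ _).2 (isHomogeneous_X _ q)), if_pos rfl]
    have hX2 : ∀ q : Fin n × Fin n, homogeneousComponent 1 ((X q : FPoly n) ^ 2) = 0 := fun q => by
      rw [homogeneousComponent_of_mem ((mem_homogeneousSubmodule _ _).2 ((isHomogeneous_X _ q).pow 2)),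
        if_neg (by norm_num)]
    have hval : ∀ i : Fin (n * n), i.val ≠ 0 → i.val ≠ 1 → i.val ≠ 2 → F₀ (chainPos n i) = 0 :=
      fun i hi0 hi1 hi2 => by
        simpa only [Fin.append_left, fanG, hi0, hi1, hi2, if_false, hX, map_X, eval_X, Pi.zero_apply]
          using hF (Fin.castAdd 1 i)
    have h2 : F₀ (chainPos n ⟨2, by omega⟩) = 0 := by
      have h := hF (Fin.castAdd 1 ⟨1, i1lt⟩)
      simp only [Fin.append_left, fanG, show (1 : ℕ) ≠ 0 from by norm_num, if_false, if_true, map_sub,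
        hX, hX2, sub_zero, map_X, eval_X, Pi.zero_apply] at h
      exact h
    have h1 : F₀ (chainPos n ⟨1, i1lt⟩) = 0 := by
      have h := hF (Fin.natAdd (n * n) (0 : Fin 1))
      simp only [Fin.append_right, homogeneousComponent_C_mul, hX, map_mul, map_C, map_X, eval_C, eval_X,
        Pi.zero_apply, mul_zero] at h
      simpa using h
    have h0 : F₀ (chainPos n ⟨0, by omega⟩) = 0 := by
      have h := hF (Fin.castAdd 1 ⟨0, by omega⟩)
      simp only [Fin.append_left, fanG, if_true, map_add, homogeneousComponent_C_mul, hX, map_mul, map_C,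
        map_X, eval_C, eval_X, Pi.zero_apply, mul_zero, add_zero, zero_add, h1] at h
      exact h
    funext q
    exact chainPos_cases h3 (P := fun q => F₀ q = 0) h0 h1 h2 hval q

/-- **THE FAN SPECIMEN, negative half.**  A realisation of the fan is CORRECT of degree `≤ 4`; over
EVERY base pair its test ideal is initially isolated to NO order `K ≤ 3` (outside the order-`2`
purification engine) and it admits NO non-zero constant kernel field (outside the constant step). -/
theorem exists_fanSystem (h3 : 3 ≤ n * n) : ∃ E : EqSystem n, E.Correct ∧ E.IsDegLe 4 ∧
    (∀ j ∈ E.tests, ∃ i, E.testPoly j = fanTest h3 i) ∧ (∀ i, ∃ j ∈ E.tests, E.testPoly j = fanTest h3 i) ∧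
    (∀ K, K < 4 → ∀ y, ¬ E.IdealInitIsolatedAt K y) ∧
    ∀ γ : Fin n × Fin n → ℂ,
      (∀ j ∈ E.tests, derivC (fun q => C (γ q)) (E.testPoly j) ∈ graphIdeal n) → γ = 0 := by
  classical
  obtain ⟨E, hfan, hto, hfrom⟩ := exists_realisation_list ((List.finRange (n * n)).map (fanTest h3))
  have hto' : ∀ j ∈ E.tests, ∃ i, E.testPoly j = fanTest h3 i := fun j hj => by
    obtain ⟨i, -, hi⟩ := List.mem_map.1 (hto j hj)
    exact ⟨i, hi.symm⟩
  have hfrom' : ∀ i, ∃ j ∈ E.tests, E.testPoly j = fanTest h3 i := fun i =>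
    hfrom _ (List.mem_map_of_mem (List.mem_finRange i))
  refine ⟨E, ⟨hfan, Set.ext fun x => ⟨fun hx => ?_, fun hx j hj => ?_⟩⟩, fun o => ?_, hto', hfrom',
    fun K hK y => ?_, fun γ hγ => fan_constField_eq_zero h3 γ fun i => ?_⟩
  · refine (fanTest_zero_iff h3 x).1 fun i => ?_
    obtain ⟨j, hj, hji⟩ := hfrom' i
    rw [← hji]; exact hx j hj
  · obtain ⟨i, hi⟩ := hto' j hj
    rw [hi]; exact (fanTest_zero_iff h3 x).2 hx i
  · obtain ⟨i, hi⟩ := hto' _ (List.get_mem _ o)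
    rw [hi]; exact totalDegree_fanTest_le h3 i
  · refine not_idealInitIsolatedAt_of_maskCert (lam := fanLam h3) (w := fanW n) hK one_le_fanW (fun o => ?_)
      ⟨chainPos n ⟨1, by omega⟩, by rw [fanW_chainPos]; simp, by rw [fanLam_chainPos]; simp⟩
    obtain ⟨i, hi⟩ := hto' (E.tests.get o) (List.get_mem _ _)
    rw [hi]; exact X_pow_dvd_maskHom_fanTest h3 i
  · obtain ⟨j, hj, hji⟩ := hfrom' i
    rw [← hji]; exact hγ j hj

/-- **THE FAN SPECIMEN.**  For `n² ≥ 3`: a correct degree-`4` system `E`, order-blind below `4` and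
without constant kernel fields over EVERY base pair, and a correct system `E'` — ONE deflation of `E`
along a base-LINEAR kernel field, cost `≤ 4·cost E + 3` — REDUCED at the graph point over every
base pair.  The rung-`4` currency is the cost of polynomial kernel fields. -/
theorem fan_specimen (h3 : 3 ≤ n * n) : ∃ E E' : EqSystem n,
    E.Correct ∧ E.IsDegLe 4 ∧ (∀ K, K < 4 → ∀ y, ¬ E.IdealInitIsolatedAt K y) ∧
    (∀ γ : Fin n × Fin n → ℂ,
      (∀ j ∈ E.tests, derivC (fun q => C (γ q)) (E.testPoly j) ∈ graphIdeal n) → γ = 0) ∧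
    E'.Correct ∧ (∀ y, E'.ReducedAt (graphPoint y)) ∧ E'.cost ≤ 4 * E.cost + 3 := by
  obtain ⟨E, hE, hdeg, hto, hfrom, hmask, hconst⟩ := exists_fanSystem h3
  obtain ⟨E', hE', hred, hcost⟩ := fan_purified_by_linear_field h3 hE hto hfrom
  exact ⟨E, E', hE, hdeg, hmask, hconst, hE', hred, hcost⟩

end Summit.MatrixMultiplication.MatrixMultiplication.Theorems.GraphEquations
end
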